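import Mathlib

/-!
# Discrete IMS localisation on a line — the sine/cosine partition of unity (auxiliary file)

Support file for the crux `stmt-AtomisticToContinuum-12695` (`HonestZwanzig.RobinCoercivity`), line
`limit-operator-memory-form`, stub `stub_imsLocalisation` (proved in
`HonestZwanzigRobinCoercivityStubImsLocalisation.lean`, which imports this file). Pure real analysis, no project
definitions.

Contents: the clamped cosine profile `g(x) = cos(clamp(x, −π/2, π/2))`, the discrete windows
`χ_k(t) = g(π (t − kL)/(2L))` indexed by `k = 0, …, K` on ramp coordinates `t ≤ KL` (ramps of length `L ≥ 1`), the
partition of unity `Σ_k χ_k(t)² = 1`, and the great-circle overlap bound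
`Σ_k χ_k(t) χ_k(t') ≥ cos(π(t' − t)/(2L)) ≥ 1 − π²(t − t')²/(8L²)` for `|t − t'| ≤ L`
(the discrete IMS localisation error estimate; Cycon–Froese–Kirsch–Simon, *Schrödinger Operators* §3.1).

No definitions are introduced: the profile `g : ℝ → ℝ` and the windows `χ : ℕ → ℕ → ℝ` are free function variables
pinned down by their defining equations `hg`, `hχ`, hypotheses of every lemma, discharged by `rfl` at the point of use.
-/

noncomputable section

open Real Finset

namespace Summit.AtomisticToContinuum.FouriersLaw.Theorems.HonestZwanzig.Robin

/-! ### The clamped cosine profile `g(x) = cos (clamp x [-π/2, π/2])` -/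

section Profile

variable {g : ℝ → ℝ}

/-- The profile is nonnegative. -/
theorem ims_profile_nonneg (hg : ∀ x, g x = Real.cos (max (-(π / 2)) (min (π / 2) x))) (x : ℝ) :
    0 ≤ g x := by
  rw [hg]
  refine Real.cos_nonneg_of_neg_pi_div_two_le_of_le (le_max_left _ _) (max_le ?_ (min_le_left _ _))
  linarith [Real.pi_pos]

/-- The profile vanishes to the left of `-π/2`. -/
theorem ims_profile_of_le (hg : ∀ x, g x = Real.cos (max (-(π / 2)) (min (π / 2) x))) {x : ℝ}
    (hx : x ≤ -(π / 2)) : g x = 0 := by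
  rw [hg]
  have h : max (-(π / 2)) (min (π / 2) x) = -(π / 2) :=
    max_eq_left ((min_le_right _ _).trans hx)
  rw [h, Real.cos_neg, Real.cos_pi_div_two]

/-- The profile vanishes to the right of `π/2`. -/
theorem ims_profile_of_ge (hg : ∀ x, g x = Real.cos (max (-(π / 2)) (min (π / 2) x))) {x : ℝ}
    (hx : π / 2 ≤ x) : g x = 0 := by
  rw [hg]
  have h : max (-(π / 2)) (min (π / 2) x) = π / 2 := by
    rw [min_eq_left hx]
    exact max_eq_right (by linarith [Real.pi_pos])
  rw [h, Real.cos_pi_div_two]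

/-- On `[-π/2, π/2]` the profile is the cosine. -/
theorem ims_profile_of_mem (hg : ∀ x, g x = Real.cos (max (-(π / 2)) (min (π / 2) x))) {x : ℝ}
    (h1 : -(π / 2) ≤ x) (h2 : x ≤ π / 2) : g x = Real.cos x := by
  rw [hg, min_eq_right h2, max_eq_right h1]

/-- On `[0, ∞)` the profile is `cos (min (π/2) x)`. -/
theorem ims_profile_of_nonneg (hg : ∀ x, g x = Real.cos (max (-(π / 2)) (min (π / 2) x))) {x : ℝ}
    (hx : 0 ≤ x) : g x = Real.cos (min (π / 2) x) := by
  rw [hg, max_eq_right (le_min (by linarith [Real.pi_pos]) (by linarith [Real.pi_pos]))]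

/-- The great-circle (two-term) inequality: for phases `0 ≤ φ ≤ π/2`, `φ ≤ ψ ≤ φ + π/2`,
`cos (ψ - φ) ≤ g φ · g ψ + g (φ - π/2) · g (ψ - π/2)`. -/
theorem ims_profile_two_term (hg : ∀ x, g x = Real.cos (max (-(π / 2)) (min (π / 2) x))) {φ ψ : ℝ}
    (h0 : 0 ≤ φ) (h1 : φ ≤ π / 2) (h2 : φ ≤ ψ) (h3 : ψ ≤ φ + π / 2) :
    Real.cos (ψ - φ) ≤ g φ * g ψ + g (φ - π / 2) * g (ψ - π / 2) := by
  have hψ0 : 0 ≤ ψ := h0.trans h2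
  have hψπ : ψ ≤ π := by linarith
  rw [ims_profile_of_mem hg (by linarith [Real.pi_pos]) h1, ims_profile_of_nonneg hg hψ0,
    ims_profile_of_mem hg (by linarith) (by linarith [Real.pi_pos]),
    ims_profile_of_mem hg (by linarith) (by linarith), Real.cos_sub, Real.cos_sub_pi_div_two,
    Real.cos_sub_pi_div_two]
  have hc : Real.cos ψ ≤ Real.cos (min (π / 2) ψ) :=
    Real.cos_le_cos_of_nonneg_of_le_pi (le_min (by linarith [Real.pi_pos]) hψ0) hψπ
      (min_le_right _ _)
  have hcφ : 0 ≤ Real.cos φ :=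
    Real.cos_nonneg_of_neg_pi_div_two_le_of_le (by linarith [Real.pi_pos]) h1
  nlinarith [mul_le_mul_of_nonneg_left hc hcφ]

end Profile

/-! ### The discrete windows `χ_k(t) = g (π (t - k L) / (2 L))` -/

section Windows

variable {L : ℕ} {g : ℝ → ℝ} {χ : ℕ → ℕ → ℝ}

/-- Windows are nonnegative. -/
theorem ims_chi_nonneg (hg : ∀ x, g x = Real.cos (max (-(π / 2)) (min (π / 2) x)))
    (hχ : ∀ k t, χ k t = g (π * ((t : ℝ) - k * L) / (2 * L))) (k t : ℕ) : 0 ≤ χ k t := by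
  rw [hχ]
  exact ims_profile_nonneg hg _

/-- Window `k` vanishes at coordinates `t ≤ kL - L`. -/
theorem ims_chi_eq_zero_of_le (hg : ∀ x, g x = Real.cos (max (-(π / 2)) (min (π / 2) x)))
    (hχ : ∀ k t, χ k t = g (π * ((t : ℝ) - k * L) / (2 * L))) (hL : 1 ≤ L) {k t : ℕ}
    (h : t + L ≤ k * L) : χ k t = 0 := by
  rw [hχ]
  apply ims_profile_of_le hg
  have hL' : (0 : ℝ) < L := by exact_mod_cast hL
  have h' : (t : ℝ) + L ≤ k * L := by exact_mod_cast h
  rw [div_le_iff₀ (by positivity)]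
  nlinarith [mul_le_mul_of_nonneg_left h' Real.pi_pos.le]

/-- Window `k` vanishes at coordinates `t ≥ kL + L`. -/
theorem ims_chi_eq_zero_of_ge (hg : ∀ x, g x = Real.cos (max (-(π / 2)) (min (π / 2) x)))
    (hχ : ∀ k t, χ k t = g (π * ((t : ℝ) - k * L) / (2 * L))) (hL : 1 ≤ L) {k t : ℕ}
    (h : k * L + L ≤ t) : χ k t = 0 := by
  rw [hχ]
  apply ims_profile_of_ge hg
  have hL' : (0 : ℝ) < L := by exact_mod_cast hL
  have h' : (k : ℝ) * L + L ≤ t := by exact_mod_cast h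
  rw [le_div_iff₀ (by positivity)]
  nlinarith [mul_le_mul_of_nonneg_left h' Real.pi_pos.le]

/-- Shifting the window index by one shifts the phase by `π/2`. -/
theorem ims_chi_succ (hχ : ∀ k t, χ k t = g (π * ((t : ℝ) - k * L) / (2 * L))) (hL : 1 ≤ L)
    (k t : ℕ) : χ (k + 1) t = g (π * ((t : ℝ) - k * L) / (2 * L) - π / 2) := by
  rw [hχ]
  congr 1
  have hL' : (L : ℝ) ≠ 0 := by exact_mod_cast (by omega : L ≠ 0)
  push_cast
  field_simp
  ring

/-- Every coordinate `t ≤ KL` lies in a ramp cell `[mL, mL + L]` with `m + 1 ≤ K`. -/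
theorem ims_cell {K t : ℕ} (hL : 1 ≤ L) (hK : 1 ≤ K) (ht : t ≤ K * L) :
    ∃ m : ℕ, m + 1 ≤ K ∧ m * L ≤ t ∧ t ≤ m * L + L := by
  rcases lt_or_eq_of_le ht with hlt | heq
  · exact ⟨t / L, (Nat.div_lt_iff_lt_mul hL).mpr hlt, Nat.div_mul_le_self t L,
      (Nat.lt_div_mul_add hL).le⟩
  · obtain ⟨K', rfl⟩ : ∃ K', K = K' + 1 := ⟨K - 1, (Nat.sub_add_cancel hK).symm⟩
    refine ⟨K', le_rfl, ?_, ?_⟩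
    · rw [heq, add_one_mul]; exact Nat.le_add_right _ _
    · rw [heq, add_one_mul]

/-- Partition of unity: `Σ_{k ≤ K} χ_k(t)² = 1` for every coordinate `t ≤ KL`. -/
theorem ims_chi_sum_sq (hg : ∀ x, g x = Real.cos (max (-(π / 2)) (min (π / 2) x)))
    (hχ : ∀ k t, χ k t = g (π * ((t : ℝ) - k * L) / (2 * L))) (hL : 1 ≤ L) {K t : ℕ} (hK : 1 ≤ K)
    (ht : t ≤ K * L) : ∑ k ∈ Finset.range (K + 1), χ k t ^ 2 = 1 := by
  obtain ⟨m, hmK, hm1, hm2⟩ := ims_cell hL hK ht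
  have hL' : (0 : ℝ) < L := by exact_mod_cast hL
  have hm1' : (m : ℝ) * L ≤ t := by exact_mod_cast hm1
  have hm2' : (t : ℝ) ≤ m * L + L := by exact_mod_cast hm2
  rw [Finset.sum_eq_add m (m + 1) (by omega)]
  · obtain ⟨φ, hφ⟩ : ∃ φ : ℝ, φ = π * ((t : ℝ) - m * L) / (2 * L) := ⟨_, rfl⟩
    have hφ0 : 0 ≤ φ := by
      rw [hφ]; exact div_nonneg (mul_nonneg Real.pi_pos.le (by linarith)) (by positivity)
    have hφ1 : φ ≤ π / 2 := by
      rw [hφ, div_le_iff₀ (by positivity)]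
      nlinarith [mul_le_mul_of_nonneg_left hm2' Real.pi_pos.le]
    have e1 : χ m t = Real.cos φ := by
      rw [hχ, ← ims_profile_of_mem hg (by linarith [Real.pi_pos]) hφ1, hφ]
    have e2 : χ (m + 1) t = Real.sin φ := by
      rw [ims_chi_succ hχ hL, ← hφ, ims_profile_of_mem hg (by linarith [Real.pi_pos])
        (by linarith [Real.pi_pos]), Real.cos_sub_pi_div_two]
    rw [e1, e2, Real.cos_sq_add_sin_sq]
  · rintro k - ⟨hkm, hkm1⟩
    rcases Nat.lt_or_ge k m with hlt | hge
    · have h1 : k * L + L ≤ m * L := by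
        have := Nat.mul_le_mul_right L (Nat.succ_le_of_lt hlt)
        rwa [Nat.succ_mul] at this
      rw [ims_chi_eq_zero_of_ge hg hχ hL (h1.trans hm1)]
      norm_num
    · have hk2 : m + 2 ≤ k := by omega
      have h1 : m * L + 2 * L ≤ k * L := by
        have := Nat.mul_le_mul_right L hk2
        rwa [add_mul] at this
      rw [ims_chi_eq_zero_of_le hg hχ hL (by omega : t + L ≤ k * L)]
      norm_num
  · intro h; exact absurd (Finset.mem_range.mpr (by omega)) h
  · intro h; exact absurd (Finset.mem_range.mpr (by omega)) h

/-- Great-circle lower bound for the overlap of the windows at two coordinates `t ≤ t'` at distance `≤ L`: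
`cos (π (t' - t) / (2L)) ≤ Σ_k χ_k(t) χ_k(t')`. -/
theorem ims_chi_inner_lower (hg : ∀ x, g x = Real.cos (max (-(π / 2)) (min (π / 2) x)))
    (hχ : ∀ k t, χ k t = g (π * ((t : ℝ) - k * L) / (2 * L))) (hL : 1 ≤ L) {K t t' : ℕ}
    (hK : 1 ≤ K) (htt' : t ≤ t') (ht' : t' ≤ K * L) (hd : t' ≤ t + L) :
    Real.cos (π * ((t' : ℝ) - t) / (2 * L)) ≤ ∑ k ∈ Finset.range (K + 1), χ k t * χ k t' := by
  obtain ⟨m, hmK, hm1, hm2⟩ := ims_cell hL hK (htt'.trans ht')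
  have hL' : (0 : ℝ) < L := by exact_mod_cast hL
  have hm1' : (m : ℝ) * L ≤ t := by exact_mod_cast hm1
  have hm2' : (t : ℝ) ≤ m * L + L := by exact_mod_cast hm2
  have htt'' : (t : ℝ) ≤ t' := by exact_mod_cast htt'
  have hd' : (t' : ℝ) ≤ t + L := by exact_mod_cast hd
  have hsub : ({m, m + 1} : Finset ℕ) ⊆ Finset.range (K + 1) := by
    intro x hx
    simp only [Finset.mem_insert, Finset.mem_singleton] at hx
    simp only [Finset.mem_range]
    omega
  refine le_trans ?_ (Finset.sum_le_sum_of_subset_of_nonneg hsub fun k _ _ =>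
    mul_nonneg (ims_chi_nonneg hg hχ _ _) (ims_chi_nonneg hg hχ _ _))
  rw [Finset.sum_pair (by omega : m ≠ m + 1)]
  obtain ⟨φ, hφ⟩ : ∃ φ : ℝ, φ = π * ((t : ℝ) - m * L) / (2 * L) := ⟨_, rfl⟩
  obtain ⟨ψ, hψ⟩ : ∃ ψ : ℝ, ψ = π * ((t' : ℝ) - m * L) / (2 * L) := ⟨_, rfl⟩
  have e : ψ - φ = π * ((t' : ℝ) - t) / (2 * L) := by rw [hφ, hψ]; field_simp; ring
  have hφ0 : 0 ≤ φ := by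
    rw [hφ]; exact div_nonneg (mul_nonneg Real.pi_pos.le (by linarith)) (by positivity)
  have hφ1 : φ ≤ π / 2 := by
    rw [hφ, div_le_iff₀ (by positivity)]
    nlinarith [mul_le_mul_of_nonneg_left hm2' Real.pi_pos.le]
  have hdiff0 : 0 ≤ π * ((t' : ℝ) - t) / (2 * L) :=
    div_nonneg (mul_nonneg Real.pi_pos.le (by linarith)) (by positivity)
  have hdiff1 : π * ((t' : ℝ) - t) / (2 * L) ≤ π / 2 := by
    rw [div_le_iff₀ (by positivity)]
    nlinarith [mul_le_mul_of_nonneg_left hd' Real.pi_pos.le]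
  have hφψ : φ ≤ ψ := by linarith
  have hψφ : ψ ≤ φ + π / 2 := by linarith
  have key := ims_profile_two_term hg hφ0 hφ1 hφψ hψφ
  rw [e] at key
  refine key.trans (le_of_eq ?_)
  rw [ims_chi_succ hχ hL, ims_chi_succ hχ hL, hχ, hχ, hφ, hψ]

/-- Symmetric quadratic bound on the localisation error kernel at two coordinates at distance `≤ L`:
`1 - Σ_k χ_k(t) χ_k(t') ≤ π² (t - t')² / (8 L²)`. -/
theorem ims_rho_le_sq (hg : ∀ x, g x = Real.cos (max (-(π / 2)) (min (π / 2) x)))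
    (hχ : ∀ k t, χ k t = g (π * ((t : ℝ) - k * L) / (2 * L))) (hL : 1 ≤ L) {K t t' : ℕ}
    (hK : 1 ≤ K) (ht : t ≤ K * L) (ht' : t' ≤ K * L) (h1 : t' ≤ t + L) (h2 : t ≤ t' + L) :
    1 - ∑ k ∈ Finset.range (K + 1), χ k t * χ k t' ≤
      π ^ 2 * ((t : ℝ) - t') ^ 2 / (8 * (L : ℝ) ^ 2) := by
  have hL' : (0 : ℝ) < L := by exact_mod_cast hL
  have hcos : ∀ x : ℝ, 1 - Real.cos x ≤ x ^ 2 / 2 := fun x => by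
    linarith [Real.one_sub_sq_div_two_le_cos (x := x)]
  rcases le_total t t' with h | h
  · have := ims_chi_inner_lower hg hχ hL hK h ht' h1
    calc 1 - ∑ k ∈ Finset.range (K + 1), χ k t * χ k t'
        ≤ 1 - Real.cos (π * ((t' : ℝ) - t) / (2 * L)) := by linarith
      _ ≤ (π * ((t' : ℝ) - t) / (2 * L)) ^ 2 / 2 := hcos _
      _ = π ^ 2 * ((t : ℝ) - t') ^ 2 / (8 * (L : ℝ) ^ 2) := by field_simp; ring
  · have := ims_chi_inner_lower hg hχ hL hK h ht h2
    have hcomm : ∑ k ∈ Finset.range (K + 1), χ k t * χ k t' =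
        ∑ k ∈ Finset.range (K + 1), χ k t' * χ k t :=
      Finset.sum_congr rfl fun k _ => mul_comm _ _
    rw [hcomm]
    calc 1 - ∑ k ∈ Finset.range (K + 1), χ k t' * χ k t
        ≤ 1 - Real.cos (π * ((t : ℝ) - t') / (2 * L)) := by linarith
      _ ≤ (π * ((t : ℝ) - t') / (2 * L)) ^ 2 / 2 := hcos _
      _ = π ^ 2 * ((t : ℝ) - t') ^ 2 / (8 * (L : ℝ) ^ 2) := by field_simp; ring

/-- The localisation error kernel is nonnegative: `Σ_k χ_k(t) χ_k(t') ≤ 1` (AM–GM and the partition of unity). -/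
theorem ims_rho_nonneg (hg : ∀ x, g x = Real.cos (max (-(π / 2)) (min (π / 2) x)))
    (hχ : ∀ k t, χ k t = g (π * ((t : ℝ) - k * L) / (2 * L))) (hL : 1 ≤ L) {K t t' : ℕ}
    (hK : 1 ≤ K) (ht : t ≤ K * L) (ht' : t' ≤ K * L) :
    0 ≤ 1 - ∑ k ∈ Finset.range (K + 1), χ k t * χ k t' := by
  have h1 := ims_chi_sum_sq hg hχ hL hK ht
  have h2 := ims_chi_sum_sq hg hχ hL hK ht'
  have : ∑ k ∈ Finset.range (K + 1), χ k t * χ k t' ≤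
      (∑ k ∈ Finset.range (K + 1), (χ k t ^ 2 + χ k t' ^ 2)) / 2 := by
    rw [Finset.sum_div]
    exact Finset.sum_le_sum fun k _ => by nlinarith [sq_nonneg (χ k t - χ k t')]
  rw [Finset.sum_add_distrib, h1, h2] at this
  linarith

end Windows

/-- **Overlap (kernel) bound of the IMS partition** — the registered auxiliary sub-goal of `stub_imsLocalisation`.
For the clamped cosine profile `g` and the windows `χ_k(s) = g(π (s − kL)/(2L))` (given by their defining equations),
two ramp coordinates `t ≤ t' ≤ KL` attached to sites `i, j` with `t' − t ≤ j − i` satisfy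
`1 − Σ_{k ≤ K} χ_k(t) χ_k(t') ≤ 5 (i − j)² / L²` (great-circle bound `Σ_k χ_k(t)χ_k(t') ≥ cos(π(t'−t)/(2L))` and
`π² ≤ 16`). -/
theorem imsOverlapBound : ∀ {L K t t' i j : ℕ} {g : ℝ → ℝ} {χ : ℕ → ℕ → ℝ},
    (∀ x, g x = Real.cos (max (-(Real.pi / 2)) (min (Real.pi / 2) x))) →
    (∀ k s, χ k s = g (Real.pi * ((s : ℝ) - k * L) / (2 * L))) → 1 ≤ L → 1 ≤ K →
    t ≤ K * L → t' ≤ K * L → t ≤ t' → t' + i ≤ t + j →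
    1 - ∑ k ∈ Finset.range (K + 1), χ k t * χ k t' ≤ 5 * (((i : ℝ) - j) ^ 2 / (L : ℝ) ^ 2) := by
  intro L K t t' i j g χ hg hχ hL hK ht ht' h1 h2
  have hL' : (0 : ℝ) < L := by exact_mod_cast hL
  have hS : 0 ≤ ∑ k ∈ Finset.range (K + 1), χ k t * χ k t' :=
    Finset.sum_nonneg fun k _ => mul_nonneg (ims_chi_nonneg hg hχ _ _) (ims_chi_nonneg hg hχ _ _)
  rcases Nat.lt_or_ge j (i + L) with hlt | hge
  · have hρ := ims_rho_le_sq hg hχ hL hK ht ht' (by omega) (by omega)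
    have h1' : (t : ℝ) ≤ t' := by exact_mod_cast h1
    have h2' : (t' : ℝ) + i ≤ t + j := by exact_mod_cast h2
    have hdiff : ((t : ℝ) - t') ^ 2 ≤ ((i : ℝ) - j) ^ 2 := by
      nlinarith [mul_nonneg (by linarith : (0 : ℝ) ≤ (j : ℝ) - i - (t' - t))
        (by linarith : (0 : ℝ) ≤ (j : ℝ) - i + (t' - t))]
    have hπ : π ^ 2 ≤ 16 := by nlinarith [Real.pi_le_four, Real.pi_pos.le]
    calc _ ≤ _ := hρ
      _ = (π ^ 2 / 8) * (((t : ℝ) - t') ^ 2 / (L : ℝ) ^ 2) := by field_simp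
      _ ≤ 5 * (((i : ℝ) - j) ^ 2 / (L : ℝ) ^ 2) :=
          mul_le_mul (by linarith) (div_le_div_of_nonneg_right hdiff (by positivity))
            (by positivity) (by norm_num)
  · have hji : (L : ℝ) ≤ (j : ℝ) - i := by
      have h3 : i + L ≤ j := hge
      have h4 : ((i : ℝ) + L ≤ j) := by exact_mod_cast h3
      linarith
    have hx : 1 ≤ ((i : ℝ) - j) ^ 2 / (L : ℝ) ^ 2 := by
      rw [le_div_iff₀ (by positivity), one_mul]
      have h5 : ((i : ℝ) - j) ^ 2 = ((j : ℝ) - i) ^ 2 := by ring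
      rw [h5]
      exact pow_le_pow_left₀ hL'.le hji 2
    linarith

end Summit.AtomisticToContinuum.FouriersLaw.Theorems.HonestZwanzig.Robin

end
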